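/-
COR-CM (cell pub-hodgecm2, stage 2 of the Hodge ladder) — count-neutral kernel combinatorics (seat prover-pub-hodgecm2-b23-g51-0, binder
prover b23, gen 51; lane SYLOW TRANSFER, claim HOME/INBOX.md l.23329; blanket `Census/SylowTransfer*` l.23357).  Theorems only, in seat b09's
intrinsic model (`CMF G c`, `gfaceSet`, `pairSet`, `translates`, `hodgeSpan`, `Block`, `fibreTwo` — consumed BY NAME, nothing restated) plus
Mathlib's `ModN` / dual functionals over `𝔽₂`; no definition, no certificate, no `decide`, no named fact, no geometry, no `sorry`.
`Interfaces.lean` (C1), every E term, B01 and `Transposition/*` are untouched.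
HONEST FRAMING: `HC_CM` is NOT proved, here or anywhere in the tree; nothing here is a period or a headline.
-/
import Summits.HodgeConjecture.CorCM.Census.SylowTransferComplement
import Mathlib.LinearAlgebra.FreeModule.ModN
import Mathlib.LinearAlgebra.Dual.Lemmas
import Mathlib.Algebra.Field.ZMod

/-!
# Sylow transfer, IV: abelian Sylow `2`-subgroups — a non-square central involution is complemented

Part I (`Census/SylowTransferComplement.lean`) reduced the existence of a complement of a central involution `c` to the Sylow `2`-subgroup
`P ∋ c`: `c` is complemented in `G` iff `c ∉ B` for some index-two `B ≤ P`, i.e. iff `c ∉ Φ(P)`.  For ABELIAN `P` this Frattini condition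
reads **«`c` is not a square in `P`»** (`Φ(P) = P²`), and THIS FILE proves it in that currency:
* §1 (**`exists_index_two_of_comm_not_sq`**) in a subgroup `P` on which the group law is commutative, an element `c ∈ P` that is not a square
  OF AN ELEMENT OF `P` lies outside a subgroup `B ≤ P` with `[G:B] = 2·[G:P]` (`P/P²` is an `𝔽₂`-vector space and linear functionals separate
  points — the argument of `CorCM/FaceAbelianDatum.exists_addChar_of_not_isSquare`, seat b23 gen 39, re-run inside a subgroup);
* §2 (**`exists_cpl_of_sylow_comm_not_sq`**, **`isLeast_card_gfaces_generate_fibreTwo_of_sylow_comm_not_sq`**): for a Sylow `2`-subgroup `P`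
  that is abelian and a central involution `c` that is not a square in `P`, `c` is complemented in `G` and **`μ(G, c) = φ₂(G, c)`** (gen 40ʼs
  complement law BY NAME); in particular for EVERY central involution when `P` has exponent two (**`…_of_sylow_exponent_two`**: `P ≅ (ℤ/2)ʳ`, any
  `G`), and for `|G| = 8·odd` with abelian `P` unless `P ≅ ℤ/4 × ℤ/2` and `c` is its square class (`…_of_card_eq_eight_mul_odd_comm_not_sq`).
All [folklore] bookkeeping over [Pohlmann1968, Thm 1] in the reading of [Milne1999, Prop. 2.1].

## References
* [Pohlmann1968] H. Pohlmann, Algebraic cycles on abelian varieties of complex multiplication type, Ann. of Math. 88 (1968), Thm 1.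
* [Milne1999] J. S. Milne, Lefschetz motives and the Tate conjecture, Compositio Math. 117 (1999), Prop. 2.1, p. 54.
-/

namespace Summit.HodgeConjecture.CorCM.Census.SylowTransfer

open Finset
open Summit.HodgeConjecture.CorCM.Prior.AllgGroup.RfwfAllgGroup
open Summit.HodgeConjecture.CorCM.Census.BlockParity
open Summit.HodgeConjecture.CorCM.Census.Coinvariant
open Summit.HodgeConjecture.CorCM.Census.ComplementFaces

noncomputable section

variable {G : Type*} [Group G] [Fintype G] [DecidableEq G] (c : G)

/-! ## §1 A non-square of an abelian subgroup lies outside an index-two subgroup of it -/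

omit [Fintype G] [DecidableEq G] in
/-- **In a commutative group a non-square is detected by a character of order two** (`A/A²` is an `𝔽₂`-vector space; linear functionals separate
points): a multiplicative character `ψ : A →* Multiplicative (ZMod 2)` with `ψ a ≠ 1`. [folklore] -/
theorem exists_char_of_not_isSquare {A : Type*} [CommGroup A] {a : A} (ha : ¬ IsSquare a) :
    ∃ ψ : A →* Multiplicative (ZMod 2), ψ a = Multiplicative.ofAdd 1 := by
  set x : Additive A := Additive.ofMul a with hx_def
  have hx : ModN.mkQ 2 x ≠ 0 := by
    intro h
    have hmem : x ∈ LinearMap.range (LinearMap.lsmul ℤ (Additive A) (2 : ℤ)) := (Submodule.Quotient.mk_eq_zero _).mp h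
    obtain ⟨y, hy⟩ := hmem
    apply ha
    refine ⟨Additive.toMul y, ?_⟩
    have h2 : (2 : ℤ) • y = x := hy
    rw [two_zsmul] at h2
    have := congrArg Additive.toMul h2
    simpa [x] using this.symm
  obtain ⟨f, hf⟩ := Module.Projective.exists_dual_eq_one (ZMod 2) hx
  refine ⟨AddMonoidHom.toMultiplicativeRight (f.toAddMonoidHom.comp (ModN.mkQ 2)), ?_⟩
  change Multiplicative.ofAdd (f (ModN.mkQ 2 (Additive.ofMul a))) = Multiplicative.ofAdd 1
  rw [← hx_def, hf]

omit [Fintype G] [DecidableEq G] in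
/-- **A non-square of an abelian subgroup `P` lies outside a subgroup `B ≤ P` of index two in `P`**: `[G:B] = 2·[G:P]`. [folklore] -/
theorem exists_index_two_of_comm_not_sq (P : Subgroup G) (hcomm : ∀ x ∈ P, ∀ y ∈ P, x * y = y * x) (hcP : c ∈ P)
    (hns : ∀ y ∈ P, y * y ≠ c) : ∃ B : Subgroup G, B ≤ P ∧ B.index = 2 * P.index ∧ c ∉ B := by
  letI : CommGroup P := { (inferInstance : Group P) with mul_comm := fun a b => Subtype.ext (hcomm a a.2 b b.2) }
  have hc' : ¬ IsSquare (⟨c, hcP⟩ : P) := by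
    rintro ⟨r, hr⟩
    exact hns r r.2 (congrArg Subtype.val hr).symm
  obtain ⟨ψ, hψ⟩ := exists_char_of_not_isSquare hc'
  have hψ1 : ψ ⟨c, hcP⟩ ≠ 1 := by rw [hψ]; decide
  have key : ∀ u : Multiplicative (ZMod 2), u = 1 ∨ u = Multiplicative.ofAdd 1 := by decide
  have hsurj : Function.Surjective ψ := by
    intro u
    rcases key u with rfl | rfl
    · exact ⟨1, map_one ψ⟩
    · exact ⟨_, hψ⟩
  have hidx : ψ.ker.index = 2 := by
    rw [Subgroup.index_ker, MonoidHom.range_eq_top.mpr hsurj, Subgroup.card_top, Nat.card_eq_fintype_card, Fintype.card_multiplicative,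
      ZMod.card]
  refine ⟨ψ.ker.map P.subtype, Subgroup.map_subtype_le _, by rw [Subgroup.index_map_subtype, hidx], fun hmem => hψ1 ?_⟩
  obtain ⟨y, hy, hyc⟩ := Subgroup.mem_map.mp hmem
  have : y = ⟨c, hcP⟩ := Subtype.ext hyc
  rw [← this]
  exact hy

/-! ## §2 Abelian Sylow `2`-subgroups: complements and the law -/

omit [DecidableEq G] in
/-- **A central involution that is not a square in an abelian Sylow `2`-subgroup is complemented** (the coset sign of part I on the index-two
subgroup of §1, of index `2·[G:P] ≡ 2 (mod 4)`). [folklore] -/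
theorem exists_cpl_of_sylow_comm_not_sq (P : Sylow 2 G) (hcomm : ∀ x ∈ (P : Subgroup G), ∀ y ∈ (P : Subgroup G), x * y = y * x)
    (hns : ∀ y ∈ (P : Subgroup G), y * y ≠ c) (hc2 : c * c = 1) (hcen : ∀ x : G, x * c = c * x) :
    ∃ A : Subgroup G, ∀ x : G, x ∈ A ↔ c * x ∉ A := by
  have hcP : c ∈ (P : Subgroup G) := TypeStabiliser.mem_sylow_of_central c hc2 hcen P
  obtain ⟨B, -, hB, hcB⟩ := exists_index_two_of_comm_not_sq c (P : Subgroup G) hcomm hcP hns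
  refine exists_cpl_of_index_mod_four c B hc2 hcen hcB ?_
  obtain ⟨m, hm⟩ := odd_index_sylow P
  rw [hB, hm]
  omega

/-- **ABELIAN SYLOW `2`-SUBGROUP, `c` NOT A SQUARE IN IT ⟹ `μ(G, c) = φ₂(G, c)`** (gen 40ʼs complement law BY NAME). [folklore] -/
theorem isLeast_card_gfaces_generate_fibreTwo_of_sylow_comm_not_sq (P : Sylow 2 G)
    (hcomm : ∀ x ∈ (P : Subgroup G), ∀ y ∈ (P : Subgroup G), x * y = y * x) (hns : ∀ y ∈ (P : Subgroup G), y * y ≠ c)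
    (hc2 : c * c = 1) (hc1 : c ≠ 1) (hcen : ∀ x : G, x * c = c * x) :
    IsLeast {m : ℕ | ∃ S : Finset (CMF G c →₀ ℤ), (↑S ⊆ gfaceSet G c hc2) ∧ S.card = m ∧
      hodgeSpan c hc2 ≤ Submodule.span ℤ (pairSet c) ⊔ Submodule.span ℤ (translates c S)} (fibreTwo c hc2) := by
  obtain ⟨A, hA⟩ := exists_cpl_of_sylow_comm_not_sq c P hcomm hns hc2 hcen
  exact isLeast_card_gfaces_generate_fibreTwo_of_cpl c hA hc2 hc1 hcen

/-- Block currency: `μ(G, c) = β(G, c) − 1 − δ` for an abelian Sylow `2`-subgroup and a non-square central involution. [folklore] -/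
theorem isLeast_card_gfaces_generate_of_sylow_comm_not_sq (P : Sylow 2 G)
    (hcomm : ∀ x ∈ (P : Subgroup G), ∀ y ∈ (P : Subgroup G), x * y = y * x) (hns : ∀ y ∈ (P : Subgroup G), y * y ≠ c)
    (hc2 : c * c = 1) (hc1 : c ≠ 1) (hcen : ∀ x : G, x * c = c * x) (T₀ : CMF G c) :
    IsLeast {m : ℕ | ∃ S : Finset (CMF G c →₀ ℤ), (↑S ⊆ gfaceSet G c hc2) ∧ S.card = m ∧
      hodgeSpan c hc2 ≤ Submodule.span ℤ (pairSet c) ⊔ Submodule.span ℤ (translates c S)}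
      (Fintype.card (Block c) - 1 - wdelta c T₀) := by
  obtain ⟨A, hA⟩ := exists_cpl_of_sylow_comm_not_sq c P hcomm hns hc2 hcen
  exact isLeast_card_gfaces_generate_of_cpl c hA hc2 hc1 hcen T₀

/-- **SYLOW `2`-SUBGROUP OF EXPONENT TWO (`P ≅ (ℤ/2)ʳ`) ⟹ `μ(G, c) = φ₂(G, c)` FOR EVERY CENTRAL INVOLUTION** — any finite `G`. [folklore] -/
theorem isLeast_card_gfaces_generate_fibreTwo_of_sylow_exponent_two (P : Sylow 2 G) (hexp : ∀ y ∈ (P : Subgroup G), y * y = 1)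
    (hc2 : c * c = 1) (hc1 : c ≠ 1) (hcen : ∀ x : G, x * c = c * x) :
    IsLeast {m : ℕ | ∃ S : Finset (CMF G c →₀ ℤ), (↑S ⊆ gfaceSet G c hc2) ∧ S.card = m ∧
      hodgeSpan c hc2 ≤ Submodule.span ℤ (pairSet c) ⊔ Submodule.span ℤ (translates c S)} (fibreTwo c hc2) := by
  have hinv : ∀ y ∈ (P : Subgroup G), y⁻¹ = y := fun y hy => inv_eq_of_mul_eq_one_right (hexp y hy)
  refine isLeast_card_gfaces_generate_fibreTwo_of_sylow_comm_not_sq c P (fun x hx y hy => ?_) (fun y hy h => hc1 (by rw [← h]; exact hexp y hy))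
    hc2 hc1 hcen
  rw [← hinv _ (mul_mem hx hy), mul_inv_rev, hinv x hx, hinv y hy]

/-- **`|G| = 8·odd` WITH ABELIAN SYLOW `2`-SUBGROUP ⟹ `μ(G, c) = φ₂(G, c)`** for every central involution `c ≠ 1` that is not a square in the Sylow
`2`-subgroup (all `c` for `P ≅ ℤ/2³`; all `c` but the square class for `P ≅ ℤ/4 × ℤ/2`; `P ≅ ℤ/8` is part II). [folklore] -/
theorem isLeast_card_gfaces_generate_fibreTwo_of_card_eq_eight_mul_odd_comm_not_sq {m : ℕ} (hG : Fintype.card G = 8 * m) (hm : Odd m)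
    (P : Sylow 2 G) (hcomm : ∀ x ∈ (P : Subgroup G), ∀ y ∈ (P : Subgroup G), x * y = y * x) (hns : ∀ y ∈ (P : Subgroup G), y * y ≠ c)
    (hc2 : c * c = 1) (hc1 : c ≠ 1) (hcen : ∀ x : G, x * c = c * x) :
    IsLeast {n : ℕ | ∃ S : Finset (CMF G c →₀ ℤ), (↑S ⊆ gfaceSet G c hc2) ∧ S.card = n ∧
      hodgeSpan c hc2 ≤ Submodule.span ℤ (pairSet c) ⊔ Submodule.span ℤ (translates c S)} (fibreTwo c hc2) := by
  have _ := hG; have _ := hm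
  exact isLeast_card_gfaces_generate_fibreTwo_of_sylow_comm_not_sq c P hcomm hns hc2 hc1 hcen

end

end Summit.HodgeConjecture.CorCM.Census.SylowTransfer
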